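import Mathlib
import HarnessLib
import Summits.NavierStokesRegularity.NavierStokesRegularity.Theses.SymmetryModuliCount

/-!
# Line `backward-profile-symmetrisation` — crux `SymmetryModuliCount.LinearLiouvilleSeven` (stmt-NavierStokesRegularity-4054)

Skeleton of the proving line built from the crux idea card
`Cruxes/LinearLiouvilleSeven/Ideas/backward-profile-symmetrisation.md` (triage r1-1: pass), planner
`planner-cruxplan-stmt-NavierStokesRegularity-4054-backward-profile-sym-0`, 2026-08-15. Line card:
`Cruxes/LinearLiouvilleSeven/Lines/backward-profile-symmetrisation.md`.

## Shape

By the triage's structural finding (galilean-collapse, W2.lean) the crux `LinearLiouvilleSeven` (LL7) is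
equivalent to the route target X = `TypeIAncientLiouville`; the only part of LL7 provable without X is the
`u = 0` anchor `stub_temperedStokesLiouville`, and `anchor : TemperedStokesLiouville → X → LL7` is proved
below (sorry-free).  X itself is attacked with the card's lever, BACKWARD PROFILES: for `u ∈ 𝒜_C` either the
scale-invariant amplitude `√(−t)‖u(t,·)‖_∞` tends to `0` as `t → −∞` — then `u ≡ 0` by small-data backward
uniqueness (`stub_backwardSmallness`) — or recentred zoom-OUT limits `μₙ u(μₙ² t, cₙ + μₙ x)`, `μₙ → ∞`,
converge (KNSS compactness + mild closure, `stub_backwardProfile`) to an EXTREMAL element `w ∈ 𝒜_C`: its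
amplitude attains its global supremum `m ≥ ε` at `(−1, 0)`.  Under zoom-out a spatial period `L e` of `u`
shrinks to `0`, so the profile is invariant under ALL translations along `e` (`stub_symmetryUpgrade`, the
lever) and dies on the 2.5-D leaf (`stub_translationInvariantLeaf`, KNSS 2009 Thm 5.1): this proves the
card's theorem `PeriodicTypeIAncientLiouville` (`periodicTypeIAncientLiouville_of`, sorry-free from the four
stubs) and, applied to the profile `w` itself, reduces X to its residual core
`stub_extremalAperiodicLiouville`: an extremal, spatially APERIODIC element of `𝒜_C` vanishes (OPEN — the
load-bearing stub; honest transfer C⁺ of X off the small-amplitude and translation-lattice sectors, in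
extremal normal form).  Composition (sorry-free): `typeIAncientLiouville_of`, `anchor`, `composition`,
`LinearLiouvilleSeven_of`.

Stub signatures are written over tree declarations only (the class `𝒜_C` expanded verbatim from the route
file), so that a Theorems file can restate and prove each stub by name + signature without importing this
module; the `def`s `InClassA`, `BackwardSmallnessLiouville`, … are definitionally equal readable aliases used
by the composition theorems.

Disproof used: none — no `Cruxes/LinearLiouvilleSeven/Disproof.lean` exists (checked 2026-08-15, `ledger crux ls`);
no landed `Theorems/LinearLiouvilleSeven/Negative/` lemma exists. Negatives index: 1 entry for the summit, unrelated.
-/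

set_option linter.dupNamespace false

namespace Summit.NavierStokesRegularity.NavierStokesRegularity.Cruxes.LinearLiouvilleSeven.BackwardProfileSymmetrisation

open Filter Topology

local notation "ℝ³" => EuclideanSpace ℝ (Fin 3)

/-! ## The class and the statements (readable aliases; definitionally the stub signatures below) -/

/-- The route's class `𝒜_C`, verbatim: smooth on `t < 0`, divergence free, KNSS-mild (Oseen-kernel integral
equation between any two negative times), Type-I decay in time `‖u(t,x)‖ ≤ C/√(−t)`. -/
def InClassA (C : ℝ) (u : ℝ → ℝ³ → ℝ³) : Prop :=
  ContDiffOn ℝ (⊤ : ℕ∞) (Function.uncurry u) (Set.Iio 0 ×ˢ Set.univ) ∧ (∀ t < 0,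
  Literature.Analysis.FluidPDE.VectorCalculus.IsDivFree (u t)) ∧ (∀ s t : ℝ, s < t → t < 0 → ∀ x, u t
  x = Literature.Analysis.FluidPDE.heatFlow (u s) (t - s) x - ∫ τ in Set.Ioo s t, ∫ y,
  Literature.Analysis.FluidPDE.oseenKernel (t - τ) (x - y) (u τ y) (u τ y)) ∧
  Literature.Analysis.FluidPDE.HasTypeITimeDecay C u

/-- S1 — small backward amplitude forces triviality (Kato / Koch–Tataru small-data uniqueness on `(−∞,T]` in
the scale-invariant sup norm, `u = −B_(−∞,t)(u,u)`, `√(−t)|B| ≤ cπ M²`; then forward uniqueness of bounded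
Oseen-mild solutions). Known type, size M. -/
def BackwardSmallnessLiouville : Prop :=
  ∀ (C : ℝ) (u : ℝ → EuclideanSpace ℝ (Fin 3) → EuclideanSpace ℝ (Fin 3)), InClassA C u → (∀ ε : ℝ, 0
  < ε → ∃ T : ℝ, T < 0 ∧ ∀ t ≤ T, ∀ x, Real.sqrt (-t) * ‖u t x‖ ≤ ε) → ∀ t < 0, ∀ x, u t x = 0

/-- S2 — extraction of an EXTREMAL BACKWARD PROFILE (KNSS 2009 Prop. 4.1 smoothing `knss2009_smoothing_holds`
+ Arzelà–Ascoli + closure of the Oseen identity under locally uniform limits, kernel bound (14)): if the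
amplitude `√(−t)‖u‖` stays `≥ ε` arbitrarily far back, recentred zoom-outs along near-maximisers of
`m = lim_(T→−∞) sup_(t≤T) √(−t)‖u‖` converge to `w ∈ 𝒜_C` whose amplitude attains its supremum `m ≥ ε` at
`(−1,0)`. Known type (same compactness input as the route's support `LiouvilleKillsTypeI`, stmt-4056), size L. -/
def BackwardProfileExtraction : Prop :=
  ∀ (C ε : ℝ) (u : ℝ → EuclideanSpace ℝ (Fin 3) → EuclideanSpace ℝ (Fin 3)), InClassA C u → 0 < ε → (∀
  T : ℝ, T < 0 → ∃ t ≤ T, ∃ x, ε ≤ Real.sqrt (-t) * ‖u t x‖) → ∃ (μ : ℕ → ℝ) (c : ℕ → EuclideanSpace ℝ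
  (Fin 3)) (w : ℝ → EuclideanSpace ℝ (Fin 3) → EuclideanSpace ℝ (Fin 3)), (∀ n, 0 < μ n) ∧
  Filter.Tendsto μ Filter.atTop Filter.atTop ∧ (InClassA C w) ∧ (∀ t < 0, ∀ x, Real.sqrt (-t) * ‖w t
  x‖ ≤ ‖w (-1) 0‖) ∧ ε ≤ ‖w (-1) 0‖ ∧ (∀ t < 0, TendstoLocallyUniformly (fun (n : ℕ) (x :
  EuclideanSpace ℝ (Fin 3)) => μ n • u (μ n ^ 2 * t) (c n + μ n • x)) (w t) Filter.atTop)

/-- S3 — THE LEVER (symmetry upgrade): a spatial period `L • e` of `u` becomes the period `(L/μₙ) • e → 0` of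
the zoom-outs, so a locally uniform limit with continuous slices is invariant under ALL translations along
`e` (rounding `kₙ = ⌊θ μₙ / L⌋`, `TendstoLocallyUniformly.tendsto_comp`). Elementary, size S–M. -/
def SymmetryUpgrade : Prop :=
  ∀ (L : ℝ) (e : EuclideanSpace ℝ (Fin 3)) (u : ℝ → EuclideanSpace ℝ (Fin 3) → EuclideanSpace ℝ (Fin
  3)) (μ : ℕ → ℝ) (c : ℕ → EuclideanSpace ℝ (Fin 3)) (w : ℝ → EuclideanSpace ℝ (Fin 3) →
  EuclideanSpace ℝ (Fin 3)) (t : ℝ), 0 < L → (∀ s < 0, ∀ x, u s (x + L • e) = u s x) → (∀ n, 0 < μ n)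
  → Filter.Tendsto μ Filter.atTop Filter.atTop → t < 0 → Continuous (w t) → TendstoLocallyUniformly
  (fun (n : ℕ) (x : EuclideanSpace ℝ (Fin 3)) => μ n • u (μ n ^ 2 * t) (c n + μ n • x)) (w t)
  Filter.atTop → ∀ (θ : ℝ) (x : EuclideanSpace ℝ (Fin 3)), w t (x + θ • e) = w t x

/-- S4 — the 2.5-D leaf: an element of `𝒜_C` invariant under all translations along `e ≠ 0` vanishes
(horizontal part = bounded planar ancient mild solution ⇒ `b(t)` by KNSS 2009 Thm 5.1
`KNSS2009_liouville_planar_holds`; the Oseen gauge makes `b` constant, Type-I decay makes it `0`; the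
`e`-component is then ancient caloric with decaying sup ⇒ `0`). Known, size M. -/
def TranslationInvariantLeaf : Prop :=
  ∀ (C : ℝ) (e : EuclideanSpace ℝ (Fin 3)) (u : ℝ → EuclideanSpace ℝ (Fin 3) → EuclideanSpace ℝ (Fin
  3)), InClassA C u → e ≠ 0 → (∀ θ : ℝ, ∀ t < 0, ∀ x, u t (x + θ • e) = u t x) → ∀ t < 0, ∀ x, u t x =
  0

/-- S5 — the `u = 0` anchor: tempered classical solutions of the STOKES system on `(−∞,0) × ℝ³` are
slice-wise constant (`Δq = 0` with linear growth ⇒ `q = α(t) + γ(t)·x`; `v + ∫γ` is caloric of linear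
growth and decays backward; Tychonoff). Classical, size M. The only part of LL7 provable without X. -/
def TemperedStokesLiouville : Prop :=
  ∀ (v : ℝ → EuclideanSpace ℝ (Fin 3) → EuclideanSpace ℝ (Fin 3)) (q : ℝ → EuclideanSpace ℝ (Fin 3) →
  ℝ), ContDiffOn ℝ (⊤ : ℕ∞) (Function.uncurry v) (Set.Iio 0 ×ˢ Set.univ) → ContDiffOn ℝ (⊤ : ℕ∞)
  (Function.uncurry q) (Set.Iio 0 ×ˢ Set.univ) → (∃ K : ℝ, ∀ t < 0, ∀ x, ‖v t x‖ ≤ K / Real.sqrt (-t)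
  + K * (1 + ‖x‖) / (-t) ∧ |q t x| ≤ K / (-t) + K * (1 + ‖x‖) / Real.sqrt (-t) ^ 3) → (∀ t < 0,
  Literature.Analysis.FluidPDE.VectorCalculus.IsDivFree (v t)) → (∀ t < 0, ∀ x,
  Literature.Analysis.FluidPDE.timeDeriv v t x = Laplacian.laplacian (v t) x - gradient (q t) x) → ∀ t
  < 0, ∃ b : EuclideanSpace ℝ (Fin 3), ∀ x, v t x = b

/-- S6 — the RESIDUAL CORE (open; transfer C⁺ of X): an EXTREMAL element of `𝒜_C` (scale-invariant amplitude
maximal at `(−1,0)`) with NO spatial period vanishes. Equivalent to X given S1–S4 (X ⇒ S6 trivially;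
S1+S2+S3+S4+S6 ⇒ X is `typeIAncientLiouville_of`). Why easier than X as filed: compactness is spent once and
for all (interior maximum of `√(−t)|u|`: maximum-principle / energy-at-the-max footholds, `|∇P(−1,0)| ≥ m/2`
forced), smallness is excluded (`m ≥ δ_Kato`), and every stabiliser containing a translation (periodic,
rational-angle screw) is gone. -/
def ExtremalAperiodicLiouville : Prop :=
  ∀ (C : ℝ) (u : ℝ → EuclideanSpace ℝ (Fin 3) → EuclideanSpace ℝ (Fin 3)), InClassA C u → (∀ t < 0, ∀
  x, Real.sqrt (-t) * ‖u t x‖ ≤ ‖u (-1) 0‖) → (∀ e : EuclideanSpace ℝ (Fin 3), e ≠ 0 → ∃ t < 0, ∃ x, u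
  t (x + e) ≠ u t x) → ∀ t < 0, ∀ x, u t x = 0

/-- The card's theorem (NEW as far as searched, triage §C): a KNSS-mild ancient solution with Type-I temporal
decay that is periodic in one spatial direction is identically zero. Proved below from S1–S4. -/
def PeriodicTypeIAncientLiouville : Prop :=
  ∀ (C L : ℝ) (e : EuclideanSpace ℝ (Fin 3)) (u : ℝ → EuclideanSpace ℝ (Fin 3) → EuclideanSpace ℝ (Fin
  3)), InClassA C u → e ≠ 0 → 0 < L → (∀ t < 0, ∀ x, u t (x + L • e) = u t x) → ∀ t < 0, ∀ x, u t x =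
  0

/-- Readable alias of the crux, used as the conclusion of the statement-level composition theorems so that
`LinearLiouvilleSeven_of` is the only theorem of this file concluding the crux by name. -/
def Crux : Prop :=
  Summit.NavierStokesRegularity.NavierStokesRegularity.Theses.SymmetryModuliCount.LinearLiouvilleSeven

/-! ## Registered stubs (signatures over tree declarations only) -/

/-- stub S1 `BackwardSmallnessLiouville` (known type, M): small backward scale-invariant amplitude ⇒ `u ≡ 0`.
Sources: KochTataruAdvMath2001 (14); KNSS2009 §4; LemarieRieusset2016 Ch. 8–9 (uniqueness of bounded mild
solutions); tree `OseenMildUniqueness.lean`. -/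
theorem stub_backwardSmallness :
    ∀ (C : ℝ) (u : ℝ → EuclideanSpace ℝ (Fin 3) → EuclideanSpace ℝ (Fin 3)), ContDiffOn ℝ (⊤ : ℕ∞)
    (Function.uncurry u) (Set.Iio 0 ×ˢ Set.univ) ∧ (∀ t < 0,
    Literature.Analysis.FluidPDE.VectorCalculus.IsDivFree (u t)) ∧ (∀ s t : ℝ, s < t → t < 0 → ∀ x, u t
    x = Literature.Analysis.FluidPDE.heatFlow (u s) (t - s) x - ∫ τ in Set.Ioo s t, ∫ y,
    Literature.Analysis.FluidPDE.oseenKernel (t - τ) (x - y) (u τ y) (u τ y)) ∧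
    Literature.Analysis.FluidPDE.HasTypeITimeDecay C u → (∀ ε : ℝ, 0 < ε → ∃ T : ℝ, T < 0 ∧ ∀ t ≤ T, ∀
    x, Real.sqrt (-t) * ‖u t x‖ ≤ ε) → ∀ t < 0, ∀ x, u t x = 0 := by
  sorry

/-- stub S2 `BackwardProfileExtraction` (known type, L): extremal backward profile by recentred zoom-out,
KNSS compactness and mild closure. Sources: KNSS2009 Prop. 4.1 (tree `knss2009_smoothing_holds`), §6;
SereginSverak2009 §4; Seregin2014Notes Prop. 3.9–3.11. -/
theorem stub_backwardProfile :
    ∀ (C ε : ℝ) (u : ℝ → EuclideanSpace ℝ (Fin 3) → EuclideanSpace ℝ (Fin 3)), ContDiffOn ℝ (⊤ : ℕ∞)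
    (Function.uncurry u) (Set.Iio 0 ×ˢ Set.univ) ∧ (∀ t < 0,
    Literature.Analysis.FluidPDE.VectorCalculus.IsDivFree (u t)) ∧ (∀ s t : ℝ, s < t → t < 0 → ∀ x, u t
    x = Literature.Analysis.FluidPDE.heatFlow (u s) (t - s) x - ∫ τ in Set.Ioo s t, ∫ y,
    Literature.Analysis.FluidPDE.oseenKernel (t - τ) (x - y) (u τ y) (u τ y)) ∧
    Literature.Analysis.FluidPDE.HasTypeITimeDecay C u → 0 < ε → (∀ T : ℝ, T < 0 → ∃ t ≤ T, ∃ x, ε ≤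
    Real.sqrt (-t) * ‖u t x‖) → ∃ (μ : ℕ → ℝ) (c : ℕ → EuclideanSpace ℝ (Fin 3)) (w : ℝ → EuclideanSpace
    ℝ (Fin 3) → EuclideanSpace ℝ (Fin 3)), (∀ n, 0 < μ n) ∧ Filter.Tendsto μ Filter.atTop Filter.atTop ∧
    (ContDiffOn ℝ (⊤ : ℕ∞) (Function.uncurry w) (Set.Iio 0 ×ˢ Set.univ) ∧ (∀ t < 0,
    Literature.Analysis.FluidPDE.VectorCalculus.IsDivFree (w t)) ∧ (∀ s t : ℝ, s < t → t < 0 → ∀ x, w t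
    x = Literature.Analysis.FluidPDE.heatFlow (w s) (t - s) x - ∫ τ in Set.Ioo s t, ∫ y,
    Literature.Analysis.FluidPDE.oseenKernel (t - τ) (x - y) (w τ y) (w τ y)) ∧
    Literature.Analysis.FluidPDE.HasTypeITimeDecay C w) ∧ (∀ t < 0, ∀ x, Real.sqrt (-t) * ‖w t x‖ ≤ ‖w
    (-1) 0‖) ∧ ε ≤ ‖w (-1) 0‖ ∧ (∀ t < 0, TendstoLocallyUniformly (fun (n : ℕ) (x : EuclideanSpace ℝ
    (Fin 3)) => μ n • u (μ n ^ 2 * t) (c n + μ n • x)) (w t) Filter.atTop) := by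
  sorry

/-- stub S3 `SymmetryUpgrade` (elementary, S–M; the card's lever): periods shrink under zoom-out, limits are
invariant under the whole one-parameter translation group. Sources: the idea card; Mathlib
`TendstoLocallyUniformly.tendsto_comp`. -/
theorem stub_symmetryUpgrade :
    ∀ (L : ℝ) (e : EuclideanSpace ℝ (Fin 3)) (u : ℝ → EuclideanSpace ℝ (Fin 3) → EuclideanSpace ℝ (Fin
    3)) (μ : ℕ → ℝ) (c : ℕ → EuclideanSpace ℝ (Fin 3)) (w : ℝ → EuclideanSpace ℝ (Fin 3) →
    EuclideanSpace ℝ (Fin 3)) (t : ℝ), 0 < L → (∀ s < 0, ∀ x, u s (x + L • e) = u s x) → (∀ n, 0 < μ n)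
    → Filter.Tendsto μ Filter.atTop Filter.atTop → t < 0 → Continuous (w t) → TendstoLocallyUniformly
    (fun (n : ℕ) (x : EuclideanSpace ℝ (Fin 3)) => μ n • u (μ n ^ 2 * t) (c n + μ n • x)) (w t)
    Filter.atTop → ∀ (θ : ℝ) (x : EuclideanSpace ℝ (Fin 3)), w t (x + θ • e) = w t x := by
  sorry

/-- stub S4 `TranslationInvariantLeaf` (known, M): the 2.5-D leaf of the route's census. Sources: KNSS2009
Thm 5.1 (tree fact `KNSS2009_liouville_planar`, proved: `KNSS2009_liouville_planar_holds`); triage §C.4 for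
the explicit-kernel computation (`oseenWeightA/B` moment identity). -/
theorem stub_translationInvariantLeaf :
    ∀ (C : ℝ) (e : EuclideanSpace ℝ (Fin 3)) (u : ℝ → EuclideanSpace ℝ (Fin 3) → EuclideanSpace ℝ (Fin
    3)), ContDiffOn ℝ (⊤ : ℕ∞) (Function.uncurry u) (Set.Iio 0 ×ˢ Set.univ) ∧ (∀ t < 0,
    Literature.Analysis.FluidPDE.VectorCalculus.IsDivFree (u t)) ∧ (∀ s t : ℝ, s < t → t < 0 → ∀ x, u t
    x = Literature.Analysis.FluidPDE.heatFlow (u s) (t - s) x - ∫ τ in Set.Ioo s t, ∫ y,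
    Literature.Analysis.FluidPDE.oseenKernel (t - τ) (x - y) (u τ y) (u τ y)) ∧
    Literature.Analysis.FluidPDE.HasTypeITimeDecay C u → e ≠ 0 → (∀ θ : ℝ, ∀ t < 0, ∀ x, u t (x + θ • e)
    = u t x) → ∀ t < 0, ∀ x, u t x = 0 := by
  sorry

/-- stub S5 `TemperedStokesLiouville` (classical, M): the `u = 0` anchor. Sources: triage §A.4 (harmonic
pressure of linear growth is affine; Tychonoff uniqueness for the heat equation); EscauriazaSereginSverak2003
(backward uniqueness background). -/
theorem stub_temperedStokesLiouville :
    ∀ (v : ℝ → EuclideanSpace ℝ (Fin 3) → EuclideanSpace ℝ (Fin 3)) (q : ℝ → EuclideanSpace ℝ (Fin 3) →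
    ℝ), ContDiffOn ℝ (⊤ : ℕ∞) (Function.uncurry v) (Set.Iio 0 ×ˢ Set.univ) → ContDiffOn ℝ (⊤ : ℕ∞)
    (Function.uncurry q) (Set.Iio 0 ×ˢ Set.univ) → (∃ K : ℝ, ∀ t < 0, ∀ x, ‖v t x‖ ≤ K / Real.sqrt (-t)
    + K * (1 + ‖x‖) / (-t) ∧ |q t x| ≤ K / (-t) + K * (1 + ‖x‖) / Real.sqrt (-t) ^ 3) → (∀ t < 0,
    Literature.Analysis.FluidPDE.VectorCalculus.IsDivFree (v t)) → (∀ t < 0, ∀ x,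
    Literature.Analysis.FluidPDE.timeDeriv v t x = Laplacian.laplacian (v t) x - gradient (q t) x) → ∀ t
    < 0, ∃ b : EuclideanSpace ℝ (Fin 3), ∀ x, v t x = b := by
  sorry

/-- stub S6 `ExtremalAperiodicLiouville` (OPEN — hardest, load-bearing): extremal aperiodic elements of `𝒜_C`
vanish. Sources: KNSS2009 §6 (the (L') conjecture), BradshawTsai2017CPDE Open Problem 5.1 and Tsai2018
Conj. 8.8–8.9 (what a counterexample would be: a symmetry-free or DSS backward profile), PolacikQuittnerSouplet2007
doubling/extremal normal form for Liouville theorems. -/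
theorem stub_extremalAperiodicLiouville :
    ∀ (C : ℝ) (u : ℝ → EuclideanSpace ℝ (Fin 3) → EuclideanSpace ℝ (Fin 3)), ContDiffOn ℝ (⊤ : ℕ∞)
    (Function.uncurry u) (Set.Iio 0 ×ˢ Set.univ) ∧ (∀ t < 0,
    Literature.Analysis.FluidPDE.VectorCalculus.IsDivFree (u t)) ∧ (∀ s t : ℝ, s < t → t < 0 → ∀ x, u t
    x = Literature.Analysis.FluidPDE.heatFlow (u s) (t - s) x - ∫ τ in Set.Ioo s t, ∫ y,
    Literature.Analysis.FluidPDE.oseenKernel (t - τ) (x - y) (u τ y) (u τ y)) ∧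
    Literature.Analysis.FluidPDE.HasTypeITimeDecay C u → (∀ t < 0, ∀ x, Real.sqrt (-t) * ‖u t x‖ ≤ ‖u
    (-1) 0‖) → (∀ e : EuclideanSpace ℝ (Fin 3), e ≠ 0 → ∃ t < 0, ∃ x, u t (x + e) ≠ u t x) → ∀ t < 0, ∀
    x, u t x = 0 := by
  sorry

/-! ## Composition (sorry-free) -/

/-- Slices of a jointly smooth field on `t < 0` are continuous. -/
theorem continuous_slice {u : ℝ → ℝ³ → ℝ³}
    (hu : ContDiffOn ℝ (⊤ : ℕ∞) (Function.uncurry u) (Set.Iio 0 ×ˢ Set.univ)) {t : ℝ} (ht : t < 0) :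
    Continuous (u t) := by
  have hc : Continuous (fun x : ℝ³ => ((t, x) : ℝ × ℝ³)) := continuous_const.prodMk continuous_id
  have h := hu.continuousOn.comp_continuous hc
    (fun x => Set.mk_mem_prod (Set.mem_Iio.2 ht) (Set.mem_univ x))
  simpa [Function.comp_def] using h

/-- The card's theorem from S1–S4: periodic Type-I ancient mild solutions vanish. -/
theorem periodicTypeIAncientLiouville_of (h1 : BackwardSmallnessLiouville) (h2 : BackwardProfileExtraction)
    (h3 : SymmetryUpgrade) (h4 : TranslationInvariantLeaf) : PeriodicTypeIAncientLiouville := by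
  intro C L e u hu he hL hper
  by_contra hne
  by_cases hsmall : ∀ ε : ℝ, 0 < ε → ∃ T : ℝ, T < 0 ∧ ∀ t ≤ T, ∀ x, Real.sqrt (-t) * ‖u t x‖ ≤ ε
  · exact hne (h1 C u hu hsmall)
  push Not at hsmall
  obtain ⟨ε, hε, hpers⟩ := hsmall
  obtain ⟨μ, c, w, hμ, hμlim, hw, -, hwε, hconv⟩ := h2 C ε u hu hε (fun T hT => by
    obtain ⟨t, ht, x, hx⟩ := hpers T hT
    exact ⟨t, ht, x, hx.le⟩)
  have hinv : ∀ θ : ℝ, ∀ t < 0, ∀ x, w t (x + θ • e) = w t x := fun θ t ht x =>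
    h3 L e u μ c w t hL hper hμ hμlim ht (continuous_slice hw.1 ht) (hconv t ht) θ x
  have h0 : w (-1) 0 = 0 := h4 C e w hw he hinv (-1) (by norm_num) 0
  rw [h0, norm_zero] at hwε
  exact absurd hwε (not_le.2 hε)

/-- X = `TypeIAncientLiouville` (the route target, stmt-4050) from S1, S2, S3, S4 and the residual core S6:
small amplitude ⇒ S1; otherwise S2 gives a nonzero extremal profile `w`; if `w` has a spatial period it dies by
the periodic theorem (S1–S4 applied to `w`), otherwise by S6. -/
theorem typeIAncientLiouville_of (h1 : BackwardSmallnessLiouville) (h2 : BackwardProfileExtraction)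
    (h3 : SymmetryUpgrade) (h4 : TranslationInvariantLeaf) (h6 : ExtremalAperiodicLiouville) :
    Summit.NavierStokesRegularity.NavierStokesRegularity.Theses.SymmetryModuliCount.TypeIAncientLiouville := by
  intro C u hu
  by_contra hne
  by_cases hsmall : ∀ ε : ℝ, 0 < ε → ∃ T : ℝ, T < 0 ∧ ∀ t ≤ T, ∀ x, Real.sqrt (-t) * ‖u t x‖ ≤ ε
  · exact hne (h1 C u hu hsmall)
  push Not at hsmall
  obtain ⟨ε, hε, hpers⟩ := hsmall
  obtain ⟨μ, c, w, -, -, hw, hext, hwε, -⟩ := h2 C ε u hu hε (fun T hT => by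
    obtain ⟨t, ht, x, hx⟩ := hpers T hT
    exact ⟨t, ht, x, hx.le⟩)
  have hw0 : ∀ t < 0, ∀ x, w t x = 0 := by
    by_cases hperw : ∃ e : ℝ³, e ≠ 0 ∧ ∀ t < 0, ∀ x, w t (x + e) = w t x
    · obtain ⟨e, he, hpe⟩ := hperw
      refine periodicTypeIAncientLiouville_of h1 h2 h3 h4 C 1 e w hw he one_pos ?_
      intro t ht x
      simpa using hpe t ht x
    · push Not at hperw
      exact h6 C w hw hext hperw
  have h0 : w (-1) 0 = 0 := hw0 (-1) (by norm_num) 0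
  rw [h0, norm_zero] at hwε
  exact absurd hwε (not_le.2 hε)

/-- The anchor direction (triage W2.lean, re-proved here): S5 and X give the crux — around `u ≡ 0` every
tempered linearised solution is a tempered Stokes solution, hence slice-constant, and `c = (1,0,…,0)` is a
nontrivial slice-constant combination. -/
theorem anchor (h5 : TemperedStokesLiouville)
    (hX : Summit.NavierStokesRegularity.NavierStokesRegularity.Theses.SymmetryModuliCount.TypeIAncientLiouville) : Crux := by
  intro C u hu v q hvq
  have hu0 : ∀ t < 0, u t = 0 := fun t ht => funext fun x => hX C u hu t ht x
  obtain ⟨hv, hq, hK, hdiv, heq⟩ := hvq 0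
  have hstokes : ∀ t < 0, ∀ x, Literature.Analysis.FluidPDE.timeDeriv (v 0) t x =
      Laplacian.laplacian (v 0 t) x - gradient (q 0 t) x := by
    intro t ht x
    have h := heq t ht x
    rw [hu0 t ht] at h
    simpa [Literature.Analysis.FluidPDE.convect] using h
  have hb := h5 (v 0) (q 0) hv hq hK hdiv hstokes
  refine ⟨fun i => if i = 0 then 1 else 0, ?_, ?_⟩
  · intro hc
    have h := congrFun hc 0
    simp at h
  · intro t ht
    obtain ⟨b, hb⟩ := hb t ht
    refine ⟨b, fun x => ?_⟩
    simp [ite_smul, Finset.sum_ite_eq', hb]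

/-- Statement-level composition: S1 → S2 → S3 → S4 → S5 → S6 → crux. -/
theorem composition (h1 : BackwardSmallnessLiouville) (h2 : BackwardProfileExtraction) (h3 : SymmetryUpgrade)
    (h4 : TranslationInvariantLeaf) (h5 : TemperedStokesLiouville) (h6 : ExtremalAperiodicLiouville) : Crux :=
  anchor h5 (typeIAncientLiouville_of h1 h2 h3 h4 h6)

/-- THE SKELETON: the crux `SymmetryModuliCount.LinearLiouvilleSeven` by name, from the six registered stubs
(sorries only inside `stub_*`). -/
theorem LinearLiouvilleSeven_of :
    Summit.NavierStokesRegularity.NavierStokesRegularity.Theses.SymmetryModuliCount.LinearLiouvilleSeven :=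
  composition stub_backwardSmallness stub_backwardProfile stub_symmetryUpgrade stub_translationInvariantLeaf
    stub_temperedStokesLiouville stub_extremalAperiodicLiouville

end Summit.NavierStokesRegularity.NavierStokesRegularity.Cruxes.LinearLiouvilleSeven.BackwardProfileSymmetrisation
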